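import Summits.QuantumFields.BalabanUV.T4Continuum.Support.NE7K1LinWalkCubes
import Summits.QuantumFields.BalabanUV.T4Continuum.Support.NE7K1LinTwoRunFaces

/-!
# NE7K1LinWalkBox — row NE7 (node U5), candidate route HOM, path H1L, cell K1-lin(s): THE CUBE SYSTEM ON AN ALIGNED BOX — the
# Neumann second difference of the product cut-offs summed over the neighbours PRESENT in the box, the regions `S_J` with their range
# margin, support ∕ interior ∕ disjointness ∕ separation of labels, and the range of Bałaban's A = 0 operator

Lineage `b2b-balaban-t4-ne7-p2` (CRUX PROVER NE7 #2), generation 68; series (RW) file 7 (over `NE7K1LinWalkCubes`; `NE7K1LinTwoRunFaces`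
for `sum_dir_ite_eq` «the 2(d+1) directions enumerate the nearest neighbours»).  On the box `R = Π_μ[0,(2K_μ+1)W)` of `ℤ^{d+1}`:

* `sum_coe_ite_eq`, **`sum_filter_nbrs_eq_sum_dir`** — a sum over the neighbours of `x` that lie IN `R` is the sum over the `2(d+1)`
  directions with membership indicators; hence **`abs_sum_nbrs_cut_sub_le`**: `|Σ_{y ∼ x, y ∈ R}(cut x − cut y)| ≤ 32(d+1)∕W²` at EVERY site
  (`NE7K1LinWalkCubes.abs_dirDiff_le`) — the hypothesis `hlap` of `NE7K1LinWalkCommutator.comm_mulVec_sq_le_fineOpR` with `ℓ₂ = 32(d+1)∕W²`.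
* `region W ρ J` = the sites of `R` with `(2J_μ − 1)W − ρ ≤ x_μ ≤ (2J_μ + 2)W + ρ` (the cut-off's support cube enlarged by the range margin
  `ρ`): **`mem_region_of_cut_ne_zero`** (a site within `ρ` of the support lies in the region — `CutoffOn`'s two clauses for any operator of
  range `≤ ρ`), **`disjoint_region`** (labels at sup-distance `≥ 2` have disjoint regions once `2ρ < W`), `labelAdj_of_mem_region` (two regions
  sharing a site have adjacent labels — the overlap counts), **`label_sep_of_far`** (sites `≥ (2N+3)W + ρ` apart in some coordinate are carried
  by labels `≥ N` apart — the `N` of `B4RandomWalk213.lattice_walk_decay_bound`).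
* **`fineOpR_ne_zero_close`** — Bałaban's A = 0 operator `fineOpR n a 0 R` has range `≤ n` in every coordinate (diagonal, nearest neighbours,
  same `n`-block), so `ρ = n` is an admissible margin.

HONEST FRAMING: [folklore] finite combinatorics of a box; nothing of Bałaban's asserted; no `sorry`.  Census only; NO letter ∕ tag ∕ size of
NE7 moves; NE7 NOT PRINTED ∕ NOT PROVED; spine 0∕9; FIXED FINITE T⁴, rung (B)+1; NOT infinite volume, NOT mass gap, NOT Clay.  HONEST
DEPENDENCY: continuum YM on T⁴ ⇐ BetaPertH ∧ nine spine estimates (0/9 proved); BetaPertH ⇐ (D1) ∧ (D4) ∧ CAP+tail; G-an2-4 gates asym,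
D1 and NE2/3/4.
-/

noncomputable section

open Finset

namespace Summit.QuantumFields.BalabanUV.T4Continuum.NE7K1LinWalkBox

open NE7K1LinWalkProfile NE7K1LinWalkCubes
open NE7K1LinTwoRunFaces (sum_dir_ite_eq)
open Literature.MathematicalPhysics.QuantumFieldTheory.Balaban1983to89
open Literature.MathematicalPhysics.QuantumFieldTheory.Balaban1983to89.B4Reflection242
open Literature.MathematicalPhysics.QuantumFieldTheory.Balaban1983to89.B4BoxCov237
open Literature.MathematicalPhysics.QuantumFieldTheory.Balaban1983to89.B4Lower18

variable {d : ℕ}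

/-! ### §1 Sums over the neighbours present in a region -/

/-- a subtype sum with a point mass: `Σ_{y ∈ R} [y = z]·g(y) = [z ∈ R]·g(z)`. [folklore] -/
theorem sum_coe_ite_eq (R : Finset (Fin (d + 1) → ℤ)) (z : Fin (d + 1) → ℤ) (g : (Fin (d + 1) → ℤ) → ℝ) :
    ∑ y : ↥R, (if (y : Fin (d + 1) → ℤ) = z then g y else 0) = if z ∈ R then g z else 0 := by
  classical
  by_cases hz : z ∈ R
  · rw [if_pos hz, Finset.sum_eq_single ⟨z, hz⟩]
    · simp
    · intro y _ hy
      rw [if_neg]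
      exact fun h => hy (Subtype.ext h)
    · intro h; exact absurd (Finset.mem_univ _) h
  · rw [if_neg hz]
    refine Finset.sum_eq_zero fun y _ => ?_
    rw [if_neg]
    exact fun h => hz (h ▸ y.2)

/-- **NEIGHBOUR SUMS BY DIRECTIONS**: `Σ_{y ∼ x, y ∈ R}(g x − g y) = Σ_μ([x+e_μ ∈ R](g x − g(x+e_μ)) + [x−e_μ ∈ R](g x − g(x−e_μ)))`. [folklore] -/
theorem sum_filter_nbrs_eq_sum_dir (R : Finset (Fin (d + 1) → ℤ)) (x : ↥R) (g : (Fin (d + 1) → ℤ) → ℝ) :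
    ∑ y ∈ univ.filter (fun y : ↥R => y.1 ∈ nbrs x.1), (g x.1 - g y.1) =
      ∑ μ : Fin (d + 1), ((if x.1 + uvec μ ∈ R then g x.1 - g (x.1 + uvec μ) else 0) +
        (if x.1 - uvec μ ∈ R then g x.1 - g (x.1 - uvec μ) else 0)) := by
  classical
  rw [Finset.sum_filter]
  have h1 : ∀ y : ↥R, (if y.1 ∈ nbrs x.1 then g x.1 - g y.1 else 0) =
      ∑ μ : Fin (d + 1), ((if y.1 = x.1 + uvec μ then g x.1 - g y.1 else 0) + (if y.1 = x.1 - uvec μ then g x.1 - g y.1 else 0)) :=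
    fun y => (sum_dir_ite_eq x.1 y.1 (g x.1 - g y.1)).symm
  simp_rw [h1]
  rw [Finset.sum_comm]
  refine Finset.sum_congr rfl fun μ _ => ?_
  rw [Finset.sum_add_distrib, sum_coe_ite_eq R (x.1 + uvec μ) (fun w => g x.1 - g w),
    sum_coe_ite_eq R (x.1 - uvec μ) (fun w => g x.1 - g w)]

/-- **THE NEUMANN SECOND DIFFERENCE OF THE CUT-OFF, SUMMED OVER THE NEIGHBOURS PRESENT IN THE ALIGNED BOX, IS `O(W^{−2})`**:
`|Σ_{y ∼ x, y ∈ R}(cut x − cut y)| ≤ 32(d+1)∕W²` for `R = Π_μ[0,(2K_μ+1)W)`, `W ≥ 2` — the hypothesis `hlap` of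
`NE7K1LinWalkCommutator.comm_mulVec_sq_le_fineOpR`. [cite: Balaban1983RegularityDecay, p.575 «|Δh_j| = O(M⁻²)», dictionary] [folklore] -/
theorem abs_sum_nbrs_cut_sub_le {W : ℕ} (hW : 2 ≤ W) (K : Fin (d + 1) → ℕ) (J : Fin (d + 1) → ℕ)
    (x : ↥(boxDom fun μ => (2 * K μ + 1) * W)) :
    |∑ y ∈ univ.filter (fun y : ↥(boxDom fun μ => (2 * K μ + 1) * W) => y.1 ∈ nbrs x.1), (cut W J x.1 - cut W J y.1)| ≤
      32 * ((d : ℝ) + 1) / (W : ℝ) ^ 2 := by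
  rw [sum_filter_nbrs_eq_sum_dir]
  refine (Finset.abs_sum_le_sum_abs _ _).trans ?_
  refine (Finset.sum_le_sum fun μ _ => abs_dirDiff_le hW K J x.2 μ).trans (le_of_eq ?_)
  rw [Finset.sum_const, Finset.card_univ, Fintype.card_fin, nsmul_eq_mul]; push_cast; ring

/-! ### §2 The regions and their geometry -/

/-- **THE REGION OF LABEL `J`**: the sites of `R` within `ρ` of the cut-off's support cube, `(2J_μ−1)W − ρ ≤ x_μ ≤ (2J_μ+2)W + ρ`.
(B4's cube `□_j` around `supp h_j`, enlarged by the range of the operator.) [cite: Balaban1983RegularityDecay, (2.2) p.575 «□_j», dictionary] [folklore] -/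
def region (R : Finset (Fin (d + 1) → ℤ)) (W ρ : ℕ) (J : Fin (d + 1) → ℕ) : Finset ↥R :=
  univ.filter fun y : ↥R => ∀ μ, (2 * (J μ : ℤ) - 1) * W - ρ ≤ y.1 μ ∧ y.1 μ ≤ (2 * (J μ : ℤ) + 2) * W + ρ

/-- membership in a region, unfolded. [folklore] -/
theorem mem_region {R : Finset (Fin (d + 1) → ℤ)} {W ρ : ℕ} {J : Fin (d + 1) → ℕ} {y : ↥R} :
    y ∈ region R W ρ J ↔ ∀ μ, (2 * (J μ : ℤ) - 1) * W - ρ ≤ y.1 μ ∧ y.1 μ ≤ (2 * (J μ : ℤ) + 2) * W + ρ := by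
  simp [region]

/-- the support bounds of `NE7K1LinWalkCubes.cut_ne_zero_bounds` as INTEGER inequalities. [folklore] -/
theorem cut_ne_zero_bounds_int {W : ℕ} (hW : 1 ≤ W) {J : Fin (d + 1) → ℕ} {x : Fin (d + 1) → ℤ} (h : cut W J x ≠ 0)
    (μ : Fin (d + 1)) : (2 * (J μ : ℤ) - 1) * W < x μ ∧ x μ < (2 * (J μ : ℤ) + 2) * W := by
  have h1 := cut_ne_zero_bounds hW h μ
  constructor
  · have : ((((2 * (J μ : ℤ) - 1) * W : ℤ)) : ℝ) < ((x μ : ℤ) : ℝ) := by push_cast; linarith [h1.1]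
    exact_mod_cast this
  · have : ((x μ : ℤ) : ℝ) < ((((2 * (J μ : ℤ) + 2) * W : ℤ)) : ℝ) := by push_cast; linarith [h1.2]
    exact_mod_cast this

/-- **SUPPORT AND INTERIOR**: a site within `ρ` (in every coordinate) of a site where `cut_J` does not vanish lies in the region of `J` —
both clauses of `NE7K1LinWalkParametrix.CutoffOn` for an operator of coordinate range `≤ ρ`. [folklore] -/
theorem mem_region_of_cut_ne_zero {R : Finset (Fin (d + 1) → ℤ)} {W ρ : ℕ} (hW : 1 ≤ W) {J : Fin (d + 1) → ℕ} {x y : ↥R}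
    (h : cut W J x.1 ≠ 0) (hxy : ∀ μ, |x.1 μ - y.1 μ| ≤ ρ) : y ∈ region R W ρ J := by
  rw [mem_region]
  intro μ
  have h1 := cut_ne_zero_bounds_int hW h μ
  have h2 := hxy μ
  rw [abs_le] at h2
  constructor <;> linarith [h1.1, h1.2, h2.1, h2.2]

/-- in particular the site itself lies in its region. [folklore] -/
theorem mem_region_self_of_cut_ne_zero {R : Finset (Fin (d + 1) → ℤ)} {W ρ : ℕ} (hW : 1 ≤ W) {J : Fin (d + 1) → ℕ} {x : ↥R}
    (h : cut W J x.1 ≠ 0) : x ∈ region R W ρ J :=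
  mem_region_of_cut_ne_zero hW h fun μ => by simp

/-- **DISJOINTNESS**: labels at sup-distance `≥ 2` have disjoint regions once the margin satisfies `2ρ < W`. [folklore] -/
theorem disjoint_region {R : Finset (Fin (d + 1) → ℤ)} {W ρ : ℕ} (hρ : 2 * ρ < W) {J J' : Fin (d + 1) → ℕ}
    (hJJ' : ¬ ∀ μ, |(J μ : ℤ) - J' μ| ≤ 1) : Disjoint (region R W ρ J) (region R W ρ J') := by
  push Not at hJJ'
  obtain ⟨μ, hμ⟩ := hJJ'
  rw [Finset.disjoint_left]
  intro y hy hy'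
  have h1 := (mem_region.1 hy) μ
  have h2 := (mem_region.1 hy') μ
  have hρ' : 2 * (ρ : ℤ) < W := by exact_mod_cast hρ
  have hW0 : (0 : ℤ) ≤ W := by positivity
  rcases le_or_gt (J μ : ℤ) (J' μ) with hle | hgt
  · rw [abs_of_nonpos (by linarith)] at hμ
    -- J' ≥ J + 2: the upper end of J's interval is below the lower end of J''s
    nlinarith [h1.2, h2.1]
  · rw [abs_of_pos (by linarith)] at hμ
    nlinarith [h1.1, h2.2]

/-- two regions sharing a site have adjacent labels (the overlap count is a cube-adjacency count). [folklore] -/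
theorem labelAdj_of_mem_region {R : Finset (Fin (d + 1) → ℤ)} {W ρ : ℕ} (hρ : 2 * ρ < W) {J J' : Fin (d + 1) → ℕ} {y : ↥R}
    (hy : y ∈ region R W ρ J) (hy' : y ∈ region R W ρ J') : ∀ μ, |(J μ : ℤ) - J' μ| ≤ 1 := by
  by_contra h
  exact Finset.disjoint_left.mp (disjoint_region hρ h) hy hy'

/-- **SEPARATION OF LABELS**: if `cut_J(x) ≠ 0`, `y` lies in the region of `J′`, and `|x_μ − y_μ| ≥ (2N+3)W + ρ` for some `μ`, then
`|J_μ − J′_μ| ≥ N`. [folklore] -/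
theorem label_sep_of_far {R : Finset (Fin (d + 1) → ℤ)} {W ρ : ℕ} (hW : 1 ≤ W) {J J' : Fin (d + 1) → ℕ} {x y : ↥R}
    (hx : cut W J x.1 ≠ 0) (hy : y ∈ region R W ρ J') {N : ℕ} {μ : Fin (d + 1)}
    (hfar : ((2 * N + 3) * W + ρ : ℕ) ≤ |x.1 μ - y.1 μ|) : (N : ℤ) ≤ |(J μ : ℤ) - J' μ| := by
  have h1 := cut_ne_zero_bounds_int hW hx μ
  have h2 := (mem_region.1 hy) μ
  have hW1 : (1 : ℤ) ≤ W := by exact_mod_cast hW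
  push_cast at hfar
  rcases le_or_gt (y.1 μ) (x.1 μ) with hle | hgt
  · rw [abs_of_nonneg (by linarith)] at hfar
    have h3 : (N : ℤ) * W < ((J μ : ℤ) - J' μ) * W := by nlinarith [h1.1, h2.2]
    have h4 : (N : ℤ) < (J μ : ℤ) - J' μ := lt_of_mul_lt_mul_right h3 (by linarith)
    rw [abs_of_pos (by linarith)]; exact h4.le
  · rw [abs_of_neg (by linarith)] at hfar
    have h3 : (N : ℤ) * W < ((J' μ : ℤ) - J μ) * W := by nlinarith [h1.2, h2.1]
    have h4 : (N : ℤ) < (J' μ : ℤ) - J μ := lt_of_mul_lt_mul_right h3 (by linarith)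
    rw [abs_sub_comm, abs_of_pos (by linarith)]; exact h4.le

/-! ### §3 The range of Bałaban's A = 0 operator -/

/-- **RANGE OF `fineOpR`**: a nonzero entry `(fineOpR n a 0 R)_{xy}` forces `y = x`, or `y ∼ x`, or `y` in the `n`-block of `x`; in every
case `|x_μ − y_μ| ≤ n` for all `μ`. [cite: Balaban1983RegularityDecay, p. 572 (1.3)–(1.6), dictionary] [folklore] -/
theorem fineOpR_ne_zero_close {n : ℕ} (hn : 1 ≤ n) {R : Finset (Fin (d + 1) → ℤ)} {a : ℝ} {x y : ↥R}
    (h : fineOpR n a 0 R x y ≠ 0) (μ : Fin (d + 1)) : |x.1 μ - y.1 μ| ≤ n := by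
  have hn1 : (1 : ℤ) ≤ n := by exact_mod_cast hn
  by_cases hxy : y.1 = x.1
  · rw [hxy, sub_self, abs_zero]; positivity
  · by_cases hnb : y.1 ∈ nbrs x.1
    · obtain ⟨ν, hν | hν⟩ := mem_nbrs.1 hnb
      · rw [hν]; by_cases hμν : μ = ν
        · subst hμν; simp
          exact_mod_cast hn1
        · simp [hμν]
      · rw [hν]; by_cases hμν : μ = ν
        · subst hμν; simp
          exact_mod_cast hn1
        · simp [hμν]
    · by_cases hbl : blk n y.1 = blk n x.1
      · have := abs_sub_le_of_blk_eq hn hbl.symm μ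
        have h' : ((|x.1 μ - y.1 μ| : ℤ) : ℝ) ≤ ((n : ℤ) : ℝ) := by push_cast; exact this
        exact_mod_cast h'
      · exfalso; apply h
        have hxy' : y ≠ x := fun h' => hxy (congrArg Subtype.val h')
        simp [fineOpR, regionOpR, Matrix.of_apply, neumannLapR, diagK, avgK, hxy', hnb, hbl]

end Summit.QuantumFields.BalabanUV.T4Continuum.NE7K1LinWalkBox

end
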